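import Mathlib
import Summits.ResolutionOfSingularities.ResolutionOfSingularities.Theorems.WeightedInvariantLocalWeightedDropWildMonicKangarooBlowup
import Summits.ResolutionOfSingularities.ResolutionOfSingularities.Theorems.WeightedInvariantLocalWeightedDropWildMonicKangarooDefs

/-!
# `WeightedInvariant.LocalWeightedDrop`, line `hasse-ridge-face-selection`, S3ρ sub-stub S3ρD₂ `stub_wildMonicSurfaceDescent₂`:
# CASE D-d (KANGAROO), part 9 — BRIDGE: Prop. 6.2.4 in the vocabulary of `initPts` / `dInit`

Crux item stmt-ResolutionOfSingularities-8899 `LocalWeightedDrop` (route `ResolutionOfSingularities/WeightedInvariant`), engine of the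
door `HypersurfaceCentreConstruction` stmt-ResolutionOfSingularities-19897.  [OURS · L1 W4.3, chain w43, seat res-type-056 on ROADMAP item
(C8) = D-d KANGAROO of `L/res-L1-w43-stub-7/S3RHOD-ROADMAP.md`.  MODEL: S. Perlega, thesis Wien 2017 / arXiv:2011.14443, Ch. 6 §2.1
Prop. 6.2.4 [cite: Perlega2020, Prop. 6.2.4 (1)(2)], see `…WildMonicKangarooBlowup` (where the initial set is written out) and
`…WildMonicKangarooDefs` (`initPts`, `dInit`).  Nothing here is a statement of H. Hironaka's manuscript [claim: Hironaka2017, status: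
under-review]; OUR bookkeeping.]

For the KANGAROO WEIGHT `w` with `w 0 = n` (the exceptional letter) and `w 1 = 1`: `initPts w N′` IS the `(n,1)`-initial set written out in
`…WildMonicKangarooBlowup` (`initPts_eq_kangaroo`), hence Perlega's Prop. 6.2.4 reads, for `N′ = psi L '' N` (the scaled Newton set after the
monomial point step, `n ≥ 1`, `N ≠ ∅`, all points of total degree `≥ L`):
`n · dInit w (psi L '' N) ≤ δ(N) − α(N) − ε(N)` (`mul_dInit_image_psi_le_dGen`), `≤ dRes E N` (`mul_dInit_image_psi_le_dRes`), `≤ gammaL N`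
(`mul_dInit_image_psi_le_gammaL`) — the input `n·d₁ ≤ d_𝓕` of `…WildMonicKangarooStep.kangaroo_convention_lt`, with `d₁ = dInit w (newtonSet A′)`
once the consumer identifies `newtonSet A′ = psi d! '' N` (stub-7's `newtonSet_pointStep₀` / `newtonSet_pointStep_axis₀`).
AI-written; gate-accepted means sorry-free with standard axioms, not refereed.
-/

set_option linter.dupNamespace false -- mandated namespace of this single-conjunct summit

noncomputable section

namespace Summit.ResolutionOfSingularities.ResolutionOfSingularities.Theorems

namespace WildMonic

open MonicDescent

variable {w : Fin 2 → ℕ} {n : ℕ} (hw0 : w 0 = n) (hw1 : w 1 = 1)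

include hw0 hw1 in
/-- The kangaroo weight of a point: `n·Q₀ + Q₁`. -/
theorem weight_eq_kangaroo (Q : Fin 2 →₀ ℕ) : Finsupp.weight w Q = n * Q 0 + Q 1 := by
  rw [weight_fin_two, hw0, hw1, one_mul]

include hw0 hw1 in
/-- The kangaroo weight as a function. -/
theorem weight_coe_eq_kangaroo : (Finsupp.weight w : (Fin 2 →₀ ℕ) → ℕ) = fun Q => n * Q 0 + Q 1 :=
  funext fun Q => weight_eq_kangaroo hw0 hw1 Q

include hw0 hw1 in
/-- `initPts` for the kangaroo weight is the `(n,1)`-initial set written out. -/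
theorem initPts_eq_kangaroo (N' : Set (Fin 2 →₀ ℕ)) :
    initPts w N' = {Q : Fin 2 →₀ ℕ | Q ∈ N' ∧ n * Q 0 + Q 1 = sInf ((fun Q : Fin 2 →₀ ℕ => n * Q 0 + Q 1) '' N')} := by
  ext Q
  rw [mem_initPts_iff, weight_coe_eq_kangaroo hw0 hw1]
  rfl

include hw0 hw1 in
/-- `dInit` for the kangaroo weight, written out. -/
theorem dInit_eq_kangaroo (N' : Set (Fin 2 →₀ ℕ)) :
    dInit w N' =
      deltaL {Q : Fin 2 →₀ ℕ | Q ∈ N' ∧ n * Q 0 + Q 1 = sInf ((fun Q : Fin 2 →₀ ℕ => n * Q 0 + Q 1) '' N')} -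
        alphaL {Q : Fin 2 →₀ ℕ | Q ∈ N' ∧ n * Q 0 + Q 1 = sInf ((fun Q : Fin 2 →₀ ℕ => n * Q 0 + Q 1) '' N')} -
        epsL {Q : Fin 2 →₀ ℕ | Q ∈ N' ∧ n * Q 0 + Q 1 = sInf ((fun Q : Fin 2 →₀ ℕ => n * Q 0 + Q 1) '' N')} := by
  rw [dInit_eq, initPts_eq_kangaroo hw0 hw1]

variable {N : Set (Fin 2 →₀ ℕ)} {L : ℕ}

include hw0 hw1 in
/-- PERLEGA PROP. 6.2.4 (1) with `dInit`: `n · dInit w (psi L '' N) ≤ δ(N) − α(N) − ε(N)`. -/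
theorem mul_dInit_image_psi_le_dGen (hn : 1 ≤ n) (hN : N.Nonempty) (hL : ∀ P ∈ N, L ≤ P 0 + P 1) :
    n * dInit w (psi L '' N) ≤ deltaL N - alphaL N - epsL N := by
  rw [dInit_eq_kangaroo hw0 hw1]; exact mul_dInit_le_dGen hn hN hL

include hw0 hw1 in
/-- PERLEGA PROP. 6.2.4 (1) with `dInit`, boundary form: `n · dInit w (psi L '' N) ≤ dRes E N`. -/
theorem mul_dInit_image_psi_le_dRes (E : Finset (Fin 2)) (hn : 1 ≤ n) (hN : N.Nonempty) (hL : ∀ P ∈ N, L ≤ P 0 + P 1) :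
    n * dInit w (psi L '' N) ≤ dRes E N := by
  rw [dInit_eq_kangaroo hw0 hw1]; exact mul_dInit_le_dRes E hn hN hL

include hw0 hw1 in
/-- PERLEGA PROP. 6.2.4 (2) with `dInit`: `n · dInit w (psi L '' N) ≤ gammaL N`. -/
theorem mul_dInit_image_psi_le_gammaL (hn : 1 ≤ n) (hN : N.Nonempty) (hL : ∀ P ∈ N, L ≤ P 0 + P 1) :
    n * dInit w (psi L '' N) ≤ gammaL N := by
  rw [dInit_eq_kangaroo hw0 hw1]; exact mul_dInit_le_gammaL hn hN hL

end WildMonic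

end Summit.ResolutionOfSingularities.ResolutionOfSingularities.Theorems

end
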